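import Mathlib
import Summits.ResolutionOfSingularities.ResolutionOfSingularities.Theorems.WildQuotientsWildQuotientResolutionJordanFourTwistedChart

/-!
# V4U piece T — the invariants `H'`, `T'`, `M`, `Δ₇` on the twisted root chart (T-iii) and the inverse map (T-v)

(crux stmt-ResolutionOfSingularities-15640 `WildQuotients.WildQuotientResolution`, line `Sketch`,
sector `|G| = p`; programme V4U of `L/w45c/CHAIN.md` v6 §4 row stub-1 (T1), design of record
`L/w45c/V4U-DESIGN.md` §3 (planner res-L1-w45c-plan-1; cleared forms kernel-checked in
`L/w45c/W45cPlanSignaturesV6.lean` V6.1). [OURS · L1 W4.5c] — NOT a statement of any manuscript;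
replaces the role of no printed item. Prover res-L1-w45c-stub-1.)

Slots `s = X b`, `A = X a`, `ξ = X c`, `η = X d`; `ψ_T = twistedChart k n a b c d`, `Q = twistedQ`.
* T-iii: `twistedChart_hPrime : ψ_T(H') = s⁴Q`, `twistedChart_tPrime : ψ_T(T') = s⁶Q`,
  `twistedChart_mSlice : ψ_T(M) = ξs³Q`, `twistedChart_delta7 : ψ_T(Δ₇) = s¹²Q³η`.
* T-v (polynomial forms of the birational inverse `s² = T'/H'`, `ξ = sM/H'`, `η = Δ₇/H'³`,
  `A = x_a/s³`): `sq_mul_twistedChart_hPrime`, `X_c_mul_twistedChart_hPrime`,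
  `X_d_mul_twistedChart_hPrime_pow`.
* Upstairs, for ANY `k`-algebra endomorphism `σ` with the `J₄` law: `map_hPrime`, `map_tPrime`,
  `map_delta7` (invariance) and the SLICE `map_mSlice : σ M = M + H'`; on the chart
  `translate_twistedQ` (`Q` is `Σ_T`-invariant).
So `W_T = D₊(T′t) ∩ D(H′³/T′²)` maps to the locus `Q ≠ 0` and `θ = H'³/T'² ↦ Q` (stub-2's T2).
Method: `simp only [map_*]` + `linear_combination` with `2·C 2⁻¹ = 1`, `3·C 3⁻¹ = 1`, `6·C 6⁻¹ = 1`
(machine-extracted cofactors); `Δ₇` through its defining relation `x_a²Δ₇ = T'H'³ − T'³ + 3x_aT'²H'`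
and cancellation of the non-zero-divisor `s⁶A²`.
-/

-- single-problem summit: the doubled namespace component `ResolutionOfSingularities` is forced
set_option linter.dupNamespace false

noncomputable section

open MvPolynomial

namespace Summit.ResolutionOfSingularities.ResolutionOfSingularities.Theorems.WildQuotientResolution.JordanFour

section Invariants

variable (k : Type) [Field k] (n : ℕ) (a b c d : Fin n)
  (hab : a ≠ b) (hac : a ≠ c) (had : a ≠ d) (hbc : b ≠ c) (hbd : b ≠ d) (hcd : c ≠ d)
  (τ : MvPolynomial (Fin n) k →ₐ[k] MvPolynomial (Fin n) k)
  (hτc : τ (X c) = X c + X b) (hτ : ∀ i, i ≠ c → τ (X i) = X i)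
  (σ : MvPolynomial (Fin n) k →ₐ[k] MvPolynomial (Fin n) k)
  (hσb : σ (X b) = X b + X a) (hσc : σ (X c) = X c + X b) (hσd : σ (X d) = X d + X c)
  (hσ : ∀ i, i ≠ b → i ≠ c → i ≠ d → σ (X i) = X i)

/-! ### T-iii the invariants `H'`, `T'`, `M`, `Δ₇` on the chart -/

include hab hac hbc in
/-- **`ψ_T(H') = s⁴ Q`.** [OURS · L1 W4.5c] -/
theorem twistedChart_hPrime (h2 : (2 : k) ≠ 0) :
    twistedChart k n a b c d (hPrime k n a b c) = X b ^ 4 * twistedQ k n a b d := by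
  have h2u := two_mul_C_inv_two k n h2
  simp only [hPrime, twistedQ, map_sub, map_mul, map_pow, map_ofNat, twistedChart_X_a,
    twistedChart_X_b k n a b c d hab, twistedChart_X_c k n a b c d hac hbc, twistedP]
  linear_combination (X b ^ 5 * X a ^ 2 * X c - X b ^ 4 * X a ^ 2 * X c ^ 2 +
    X b ^ 4 * X a ^ 2 * X d) * h2u

include hab hac had hbc hbd hcd in
/-- **`ψ_T(T') = s⁶ Q`.** [OURS · L1 W4.5c] -/
theorem twistedChart_tPrime (h2 : (2 : k) ≠ 0) (h3 : (3 : k) ≠ 0) :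
    twistedChart k n a b c d (tPrime k n a b c d) = X b ^ 6 * twistedQ k n a b d := by
  have h2u := two_mul_C_inv_two k n h2
  have h3v := three_mul_C_inv_three k n h3
  have h6w := six_mul_C_inv_six k n h2 h3
  refine mul_left_cancel₀ (six_ne_zero' k n h2 h3) ?_
  simp only [tPrime, twistedQ, map_sub, map_add, map_mul, map_pow, map_ofNat, twistedChart_X_a,
    twistedChart_X_b k n a b c d hab, twistedChart_X_c k n a b c d hac hbc,
    twistedChart_X_d k n a b c d had hbd hcd, twistedP]
  linear_combination (9 * (X b ^ 7 * X a ^ 3 * X c ^ 2) + 18 * (X b ^ 7 * X a ^ 2 * X c) -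
      9 * (X b ^ 6 * X a ^ 3 * X c ^ 3) + 9 * (X b ^ 6 * X a ^ 3 * X c * X d) +
      9 * (X b ^ 6 * X a ^ 2 * X d)) * h2u + (6 * (X b ^ 8 * X a ^ 2)) * h3v +
    (6 * (X b ^ 8 * X a ^ 3 * X c) - 9 * (X b ^ 7 * X a ^ 3 * X c ^ 2) +
      3 * (X b ^ 6 * X a ^ 3 * X c ^ 3) - 9 * (X b ^ 6 * X a ^ 3 * X c * X d) -
      3 * (X b ^ 6 * X a ^ 2 * X d)) * h6w

include hab hac had hbc hbd hcd in
/-- **`ψ_T(M) = ξ s³ Q`** (so `M/H' ↦ ξ/s`: the rational slice). [OURS · L1 W4.5c] -/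
theorem twistedChart_mSlice (h2 : (2 : k) ≠ 0) (h3 : (3 : k) ≠ 0) :
    twistedChart k n a b c d (mSlice k n a b c d) = X c * X b ^ 3 * twistedQ k n a b d := by
  have h2u := two_mul_C_inv_two k n h2
  have h3v := three_mul_C_inv_three k n h3
  have h6w := six_mul_C_inv_six k n h2 h3
  refine mul_left_cancel₀ (six_ne_zero' k n h2 h3) ?_
  simp only [mSlice, twistedQ, map_sub, map_add, map_mul, map_pow, map_ofNat, twistedChart_X_a,
    twistedChart_X_b k n a b c d hab, twistedChart_X_c k n a b c d hac hbc,
    twistedChart_X_d k n a b c d had hbd hcd, twistedP]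
  linear_combination (-(3 * (X b ^ 4 * X a ^ 2 * X c ^ 2)) - 12 * (X b ^ 4 * X a * X c) +
      3 * (X b ^ 3 * X a ^ 2 * X c ^ 3) - 3 * (X b ^ 3 * X a ^ 2 * X c * X d) -
      6 * (X b ^ 3 * X a * X c ^ 2) - 3 * (X b ^ 3 * X a * X d)) * h2u +
    (-(6 * (X b ^ 5 * X a))) * h3v +
    (-(6 * (X b ^ 5 * X a ^ 2 * X c)) + 9 * (X b ^ 4 * X a ^ 2 * X c ^ 2) -
      3 * (X b ^ 3 * X a ^ 2 * X c ^ 3) + 9 * (X b ^ 3 * X a ^ 2 * X c * X d) +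
      3 * (X b ^ 3 * X a * X d)) * h6w

include hab hac had hbc hbd hcd in
/-- **`ψ_T(Δ₇) = s¹² Q³ η`** (from the defining relation `x_a²Δ₇ = T'H'³ − T'³ + 3x_aT'²H'` and
T-iii, cancelling the non-zero-divisor `ψ_T(x_a)² = s⁶A²`); so `η = Δ₇/H'³` on the chart.
[OURS · L1 W4.5c] -/
theorem twistedChart_delta7 (h2 : (2 : k) ≠ 0) (h3 : (3 : k) ≠ 0) :
    twistedChart k n a b c d (delta7 k n a b c d) = X b ^ 12 * twistedQ k n a b d ^ 3 * X d := by
  have hne : (X b ^ 3 * X a : MvPolynomial (Fin n) k) ^ 2 ≠ 0 :=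
    pow_ne_zero _ (mul_ne_zero (pow_ne_zero _ (X_ne_zero b)) (X_ne_zero a))
  refine mul_left_cancel₀ hne ?_
  have h := congrArg (twistedChart k n a b c d) (X_a_sq_mul_delta7 k n a b c d)
  rw [map_mul, map_pow, twistedChart_X_a] at h
  rw [h]
  simp only [map_sub, map_add, map_mul, map_pow, map_ofNat, twistedChart_X_a,
    twistedChart_hPrime k n a b c d hab hac hbc h2, twistedChart_tPrime k n a b c d hab hac had hbc hbd hcd h2 h3]
  simp only [twistedQ]
  ring

/-! ### T-v the inverse map in polynomial form: `s² = T'/H'`, `ξ = sM/H'`, `η = Δ₇/H'³`,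
`A = x_a/s³` on the chart. -/

include hab hac had hbc hbd hcd in
/-- `s² · ψ_T(H') = ψ_T(T')`. [OURS · L1 W4.5c] -/
theorem sq_mul_twistedChart_hPrime (h2 : (2 : k) ≠ 0) (h3 : (3 : k) ≠ 0) :
    X b ^ 2 * twistedChart k n a b c d (hPrime k n a b c) =
      twistedChart k n a b c d (tPrime k n a b c d) := by
  rw [twistedChart_hPrime k n a b c d hab hac hbc h2,
    twistedChart_tPrime k n a b c d hab hac had hbc hbd hcd h2 h3]
  ring

include hab hac had hbc hbd hcd in
/-- `ξ · ψ_T(H') = s · ψ_T(M)`. [OURS · L1 W4.5c] -/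
theorem X_c_mul_twistedChart_hPrime (h2 : (2 : k) ≠ 0) (h3 : (3 : k) ≠ 0) :
    X c * twistedChart k n a b c d (hPrime k n a b c) =
      X b * twistedChart k n a b c d (mSlice k n a b c d) := by
  rw [twistedChart_hPrime k n a b c d hab hac hbc h2,
    twistedChart_mSlice k n a b c d hab hac had hbc hbd hcd h2 h3]
  ring

include hab hac had hbc hbd hcd in
/-- `η · ψ_T(H')³ = ψ_T(Δ₇)`. [OURS · L1 W4.5c] -/
theorem X_d_mul_twistedChart_hPrime_pow (h2 : (2 : k) ≠ 0) (h3 : (3 : k) ≠ 0) :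
    X d * twistedChart k n a b c d (hPrime k n a b c) ^ 3 =
      twistedChart k n a b c d (delta7 k n a b c d) := by
  rw [twistedChart_hPrime k n a b c d hab hac hbc h2,
    twistedChart_delta7 k n a b c d hab hac had hbc hbd hcd h2 h3]
  ring

/-! ### The invariants upstairs: `H'`, `T'`, `Δ₇` are `σ`-invariant and `σ M = M + H'`
(every characteristic; `σ` ANY `k`-algebra endomorphism with the `J₄` law). -/

include hab hac had hσb hσc hσ in
/-- `σ H' = H'`. [OURS · L1 W4.5c] -/
theorem map_hPrime : σ (hPrime k n a b c) = hPrime k n a b c := by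
  have hσa : σ (X a) = X a := hσ a hab hac had
  simp only [hPrime, map_sub, map_mul, map_pow, map_ofNat, hσa, hσb, hσc]
  ring

include hab hac had hσb hσc hσd hσ in
/-- `σ T' = T'`. [OURS · L1 W4.5c] -/
theorem map_tPrime : σ (tPrime k n a b c d) = tPrime k n a b c d := by
  have hσa : σ (X a) = X a := hσ a hab hac had
  simp only [tPrime, map_sub, map_add, map_mul, map_pow, map_ofNat, hσa, hσb, hσc, hσd]
  ring

include hab hac had hσb hσc hσd hσ in
/-- **The slice: `σ M = M + H'`** (so `σ(M/H') = M/H' + 1`). [OURS · L1 W4.5c] -/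
theorem map_mSlice : σ (mSlice k n a b c d) = mSlice k n a b c d + hPrime k n a b c := by
  have hσa : σ (X a) = X a := hσ a hab hac had
  simp only [mSlice, hPrime, map_sub, map_add, map_mul, map_pow, map_ofNat, hσa, hσb, hσc, hσd]
  ring

include hab hac had hσb hσc hσd hσ in
/-- `σ Δ₇ = Δ₇` (through the defining relation, cancelling `x_a²`). [OURS · L1 W4.5c] -/
theorem map_delta7 : σ (delta7 k n a b c d) = delta7 k n a b c d := by
  have hσa : σ (X a) = X a := hσ a hab hac had
  have hne : (X a : MvPolynomial (Fin n) k) ^ 2 ≠ 0 := pow_ne_zero _ (X_ne_zero a)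
  refine mul_left_cancel₀ hne ?_
  have h := congrArg σ (X_a_sq_mul_delta7 k n a b c d)
  rw [map_mul, map_pow, hσa] at h
  rw [h, X_a_sq_mul_delta7]
  simp only [map_sub, map_add, map_mul, map_pow, map_ofNat, hσa,
    map_hPrime k n a b c d hab hac had σ hσb hσc hσ, map_tPrime k n a b c d hab hac had σ hσb hσc hσd hσ]

include hτ in
/-- `Q` is `Σ_T`-invariant (it does not involve `ξ`). [OURS · L1 W4.5c] -/
theorem translate_twistedQ (hac : a ≠ c) (hbc : b ≠ c) (hcd : c ≠ d) :
    τ (twistedQ k n a b d) = twistedQ k n a b d := by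
  simp only [twistedQ, map_add, map_sub, map_mul, map_pow, map_one, map_ofNat, hτ a hac, hτ b hbc,
    hτ d (Ne.symm hcd)]

end Invariants

end Summit.ResolutionOfSingularities.ResolutionOfSingularities.Theorems.WildQuotientResolution.JordanFour

end
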